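import Literature.InformationTheory.QuantumCodes.TwistedToricCycles
import Literature.InformationTheory.QuantumCodes.TwistedToricPlanar
import HarnessLib

/-!
# Toric codes on twisted tori — pushing the cover down: the class of a closed walk, and `d_Z ≥ sys₁(Λ)`

Topic `InformationTheory/QuantumCodes`; namespace `Literature.InformationTheory.QuantumCodes.TwistedToric`.
LADDER-QEC (cell `qec`), PARTITION row 08, item 08.TWIST (file 5 of the distance proof of `TwistedToricCodes.lean`).

The covering map `ℤ² → G`, `p ↦ v + (p₁•g₁ + p₂•g₂)` pushes plane chains supported in a box down to chains of the
twisted toric code (`proj`): plaquettes go to plaquettes (`proj_face`) and the lift of a walk goes to the walk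
(`proj_wchain`). With the planar lemma this gives the **class lemma**: two walks from the same vertex with the same
net displacement have chains that differ by a `Z`-stabilizer (`wchain_add_wchain_mem_rowSpZ`); hence the class of
a closed walk modulo `rs H_Z` depends only on its period `λ ∈ Λ`, additively, and a closed walk whose period lies in
`2Λ` is a stabilizer (`wchain_mem_rowSpZ_of_two_mul`). Combined with the Euler decomposition
(`TwistedToricCycles.lean`): a `Z`-logical (a cycle that is not a stabilizer) contains a closed walk whose period is
not in `2Λ`, in particular non-zero, so its weight is at least the L¹ systole —
**`systole_le_hammingNorm_of_zLogical : H_X z = 0 → z ∉ rs H_Z → sys₁(Λ) ≤ |z|`** (the lower bound «the shortest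
topologically non-trivial chain has `‖L‖` operators» of Kovalev–Pryadko, for every finite abelian `G` and every
pair `g₁, g₂`, with no generation hypothesis).

0 named facts, no instances, no notation.

## References
* [KovalevPryadko2012] Kovalev–Pryadko, arXiv:1202.0928, §III.C (p0005 L72-80: «the shortest topologically
  non-trivial qubit chain has ‖L‖ operators which leads to the code distance d(L₁,L₂) = min ‖m₁L₁+m₂L₂‖»).
* [DennisEtAl2002] Dennis–Kitaev–Landahl–Preskill, J. Math. Phys. 43 (2002), §3.1 (chunk p0008 L1-5: homologically
  trivial cycles are products of plaquettes; non-trivial cycles wrap around the torus; «the code distance is d=L»).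
-/

namespace Literature.InformationTheory.QuantumCodes

open Matrix Finset

namespace TwistedToric

section Proj

variable {G : Type*} [AddCommGroup G] [DecidableEq G]

omit [DecidableEq G] in
/-- `rel g₁ g₂ e1 = g₁`. [cite: KovalevPryadko2012, §III.C (p0005 L53-56: the unit translations of the covering lattice map to the two generators)] -/
theorem rel_unit1 (g₁ g₂ : G) : rel g₁ g₂ e1 = g₁ := rel_e1 g₁ g₂

omit [DecidableEq G] in
/-- `rel g₁ g₂ e2 = g₂`. [cite: KovalevPryadko2012, §III.C (p0005 L53-56)] -/
theorem rel_unit2 (g₁ g₂ : G) : rel g₁ g₂ e2 = g₂ := rel_e2 g₁ g₂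

/-- The covering map on edges: `inl p ↦ inl (v + rel p)`, `inr p ↦ inr (v + rel p)`. (definition)
[cite: KovalevPryadko2012, §III.C (p0005 L53-56: the plane modulo the period lattice)] -/
def projEdge (g₁ g₂ v : G) : (ℤ × ℤ) ⊕ (ℤ × ℤ) → G ⊕ G :=
  Sum.map (fun p => v + rel g₁ g₂ p) (fun p => v + rel g₁ g₂ p)

/-- The plane edges in the box `[-M, M]²` (both endpoints inside). (definition) [cite: DennisEtAl2002, §3.1 (a finite patch of the square lattice)] -/
noncomputable def boxEdges (M : ℕ) : Finset ((ℤ × ℤ) ⊕ (ℤ × ℤ)) :=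
  @Finset.filter _ (eInBox M) (Classical.decPred _)
    ((Finset.Icc (-(M : ℤ)) M ×ˢ Finset.Icc (-(M : ℤ)) M).disjSum (Finset.Icc (-(M : ℤ)) M ×ˢ Finset.Icc (-(M : ℤ)) M))

/-- Membership in `boxEdges M` is exactly `eInBox M`. [cite: DennisEtAl2002, §3.1 (finite patch)] -/
theorem mem_boxEdges {M : ℕ} {e : (ℤ × ℤ) ⊕ (ℤ × ℤ)} : e ∈ boxEdges M ↔ eInBox M e := by
  unfold boxEdges
  rw [@Finset.mem_filter _ _ (Classical.decPred _)]
  constructor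
  · exact fun h => h.2
  · intro h
    refine ⟨?_, h⟩
    rw [Finset.mem_disjSum]
    cases e with
    | inl p =>
      left; refine ⟨p, ?_, rfl⟩
      obtain ⟨⟨h1, h2, h3, h4⟩, -⟩ := h
      simp only [Finset.mem_product, Finset.mem_Icc]; omega
    | inr p =>
      right; refine ⟨p, ?_, rfl⟩
      obtain ⟨⟨h1, h2, h3, h4⟩, -⟩ := h
      simp only [Finset.mem_product, Finset.mem_Icc]; omega

/-- The box is monotone. [cite: DennisEtAl2002, §3.1 (finite patch)] -/
theorem eInBox_mono {M M' : ℕ} (h : M ≤ M') {e : (ℤ × ℤ) ⊕ (ℤ × ℤ)} (he : eInBox M e) : eInBox M' e := by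
  cases e with
  | inl p => obtain ⟨⟨h1, h2, h3, h4⟩, ⟨h5, h6, h7, h8⟩⟩ := he; exact ⟨⟨by omega, by omega, by omega, by omega⟩, ⟨by omega, by omega, by omega, by omega⟩⟩
  | inr p => obtain ⟨⟨h1, h2, h3, h4⟩, ⟨h5, h6, h7, h8⟩⟩ := he; exact ⟨⟨by omega, by omega, by omega, by omega⟩, ⟨by omega, by omega, by omega, by omega⟩⟩

/-- **Push-forward of a box-supported plane chain** along the covering map based at `v`:
`proj M v D = Σ_{ẽ ∈ box} D(ẽ) • [projEdge v ẽ]`. (definition)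
[cite: KovalevPryadko2012, §III.C (p0005 L53-56: identification of the plane modulo the period lattice)] -/
noncomputable def proj (g₁ g₂ : G) (M : ℕ) (v : G) (D : (ℤ × ℤ) ⊕ (ℤ × ℤ) → ZMod 2) : G ⊕ G → ZMod 2 :=
  ∑ e ∈ boxEdges M, D e • Pi.single (projEdge g₁ g₂ v e) (1 : ZMod 2)

/-- `proj` is additive. [cite: DennisEtAl2002, §3.1 (ℤ₂ chains)] -/
theorem proj_add (g₁ g₂ : G) (M : ℕ) (v : G) (D D' : (ℤ × ℤ) ⊕ (ℤ × ℤ) → ZMod 2) :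
    proj g₁ g₂ M v (D + D') = proj g₁ g₂ M v D + proj g₁ g₂ M v D' := by
  simp only [proj, Pi.add_apply, add_smul, Finset.sum_add_distrib]

/-- `proj` commutes with scalars. [cite: DennisEtAl2002, §3.1 (ℤ₂ chains)] -/
theorem proj_smul (g₁ g₂ : G) (M : ℕ) (v : G) (c : ZMod 2) (D : (ℤ × ℤ) ⊕ (ℤ × ℤ) → ZMod 2) :
    proj g₁ g₂ M v (c • D) = c • proj g₁ g₂ M v D := by
  simp only [proj, Pi.smul_apply, smul_eq_mul, mul_smul, Finset.smul_sum]

/-- `proj` commutes with finite sums of scaled chains. [cite: DennisEtAl2002, §3.1 (ℤ₂ chains)] -/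
theorem proj_sum_smul (g₁ g₂ : G) (M : ℕ) (v : G) (F : Finset (ℤ × ℤ)) (c : ℤ × ℤ → ZMod 2)
    (X : ℤ × ℤ → (ℤ × ℤ) ⊕ (ℤ × ℤ) → ZMod 2) :
    proj g₁ g₂ M v (∑ f ∈ F, c f • X f) = ∑ f ∈ F, c f • proj g₁ g₂ M v (X f) := by
  classical
  induction F using Finset.induction_on with
  | empty => simp [proj]
  | insert a F ha ih => rw [Finset.sum_insert ha, Finset.sum_insert ha, proj_add, proj_smul, ih]

/-- A single in-box edge is pushed to the single image edge. [cite: KovalevPryadko2012, §III.C (p0005 L53-56)] -/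
theorem proj_single (g₁ g₂ : G) {M : ℕ} (v : G) {e : (ℤ × ℤ) ⊕ (ℤ × ℤ)} (he : eInBox M e) :
    proj g₁ g₂ M v (Pi.single e 1) = Pi.single (projEdge g₁ g₂ v e) 1 := by
  simp only [proj, Pi.single_apply, ite_smul, one_smul, zero_smul]
  rw [Finset.sum_ite_eq']
  rw [if_pos (mem_boxEdges.2 he)]

/-- **Plaquettes go to plaquettes**: the plane face at `f` (edges in the box) is pushed to the code's face at
`v + rel f`. [cite: DennisEtAl2002, §3.1 (plaquette operators of the torus are images of plaquettes of the plane)] -/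
theorem proj_face (g₁ g₂ : G) {M : ℕ} (v : G) (f : ℤ × ℤ)
    (h1 : eInBox M (.inl f)) (h2 : eInBox M (.inl (f + e2))) (h3 : eInBox M (.inr f)) (h4 : eInBox M (.inr (f + e1))) :
    proj g₁ g₂ M v (face e1 e2 f) = face g₁ g₂ (v + rel g₁ g₂ f) := by
  rw [face, proj_add, proj_add, proj_add, proj_single g₁ g₂ v h1, proj_single g₁ g₂ v h2, proj_single g₁ g₂ v h3,
    proj_single g₁ g₂ v h4, face]
  simp only [projEdge, Sum.map_inl, Sum.map_inr, map_add, rel_unit1, rel_unit2, add_assoc]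

/-- Coordinates grow by at most one per step. [cite: KovalevPryadko2012, §III.C (p0005 L53-56)] -/
theorem natAbs_move_le (s : Step) (p : ℤ × ℤ) :
    (s.move e1 e2 p).1.natAbs ≤ p.1.natAbs + 1 ∧ (s.move e1 e2 p).2.natAbs ≤ p.2.natAbs + 1 := by
  cases s <;> simp [Step.move, e1, e2] <;> omega

/-- A step taken well inside the box uses an in-box edge. [cite: DennisEtAl2002, §3.1 (finite patch)] -/
theorem step_edge_inBox {M : ℕ} (s : Step) (p : ℤ × ℤ) (h1 : p.1.natAbs + 1 ≤ M) (h2 : p.2.natAbs + 1 ≤ M) :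
    eInBox M (s.edge e1 e2 p) := by
  cases s <;> simp only [Step.edge, eInBox, vInBox, e1, e2, Prod.fst_sub, Prod.snd_sub,
    Prod.fst_add, Prod.snd_add] <;> omega

/-- **The support of a lifted walk stays in the box**: a walk of length `ℓ` from `p` only touches edges of the
box of radius `|p| + ℓ + 1`. [cite: DennisEtAl2002, §3.1 (finite error chains)] -/
theorem wchain_ne_zero_inBox {M : ℕ} :
    ∀ (w : List Step) (p : ℤ × ℤ), p.1.natAbs + w.length + 1 ≤ M → p.2.natAbs + w.length + 1 ≤ M →
      ∀ e, wchain e1 e2 p w e ≠ 0 → eInBox M e := by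
  intro w
  induction w with
  | nil => intro p _ _ e he; simp at he
  | cons s t ih =>
    intro p h1 h2 e he
    rw [wchain_cons, Pi.add_apply] at he
    by_cases hes : e = s.edge e1 e2 p
    · rw [hes]; exact step_edge_inBox s p (by simp at h1; omega) (by simp at h2; omega)
    · rw [Pi.single_apply, if_neg hes, zero_add] at he
      have hm := natAbs_move_le s p
      exact ih (s.move e1 e2 p) (by simp at h1; omega) (by simp at h2; omega) e he

/-- **The lift of a walk is pushed down to the walk**: `proj (wchain_ℤ² p w) = wchain_G (v + rel p) w`.
[cite: KovalevPryadko2012, §III.C (p0005 L53-56: paths of the plane project to paths of the torus)] -/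
theorem proj_wchain (g₁ g₂ : G) {M : ℕ} (v : G) :
    ∀ (w : List Step) (p : ℤ × ℤ), p.1.natAbs + w.length + 1 ≤ M → p.2.natAbs + w.length + 1 ≤ M →
      proj g₁ g₂ M v (wchain e1 e2 p w) = wchain g₁ g₂ (v + rel g₁ g₂ p) w := by
  intro w
  induction w with
  | nil => intro p _ _; simp [proj]
  | cons s t ih =>
    intro p h1 h2
    have hm := natAbs_move_le s p
    rw [wchain_cons, wchain_cons, proj_add,
      proj_single g₁ g₂ v (step_edge_inBox (M := M) s p (by simp at h1; omega) (by simp at h2; omega)),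
      ih (s.move e1 e2 p) (by simp at h1; omega) (by simp at h2; omega)]
    have hmove : v + rel g₁ g₂ (s.move e1 e2 p) = s.move g₁ g₂ (v + rel g₁ g₂ p) := by
      rw [Step.move_eq_add_rel, Step.move_eq_add_rel, rel_e1_e2, map_add, add_assoc]
    have hedge : projEdge g₁ g₂ v (s.edge e1 e2 p) = s.edge g₁ g₂ (v + rel g₁ g₂ p) := by
      cases s <;> simp [projEdge, Step.edge, map_sub, rel_unit1, rel_unit2, add_sub_assoc]
    rw [hmove, hedge]

end Proj

/-! ## The class of a walk modulo `Z`-stabilizers -/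

section Homology

variable {G : Type*} [AddCommGroup G] [DecidableEq G] [Fintype G]

/-- A chain plus itself vanishes (`𝔽₂` coefficients). [folklore] -/
private theorem chain_add_self' {α : Type*} (x : α → ZMod 2) : x + x = 0 := by
  funext a; exact CharTwo.add_self_eq_zero (x a)

/-- **Class lemma**: two walks from the same vertex with the same net displacement have chains differing by a
`Z`-stabilizer (their lifts form a plane cycle, which bounds by the planar lemma; push the bounding plaquettes down).
[cite: DennisEtAl2002, §3.1 (chunk p0008 L1-3: homologically equivalent chains differ by the boundary of a two-chain, a product of plaquettes)] -/
theorem wchain_add_wchain_mem_rowSpZ (g₁ g₂ v : G) (w₁ w₂ : List Step) (h : ndisp w₁ = ndisp w₂) :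
    wchain g₁ g₂ v w₁ + wchain g₁ g₂ v w₂ ∈ (code g₁ g₂).rowSpZ := by
  set N := w₁.length + w₂.length + 1 with hN
  set D := wchain e1 e2 (0 : ℤ × ℤ) w₁ + wchain e1 e2 (0 : ℤ × ℤ) w₂ with hD
  have hbox : ∀ e, D e ≠ 0 → eInBox N e := by
    intro e he
    rw [hD, Pi.add_apply] at he
    by_cases h1 : wchain e1 e2 (0 : ℤ × ℤ) w₁ e = 0
    · rw [h1, zero_add] at he
      exact wchain_ne_zero_inBox w₂ 0 (by simp; omega) (by simp; omega) e he
    · exact wchain_ne_zero_inBox w₁ 0 (by simp; omega) (by simp; omega) e h1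
  have heven : ∀ q, star e1 e2 D q = 0 := by
    intro q
    rw [hD, star_add, star_wchain, star_wchain, endPos_eq, endPos_eq, rel_e1_e2, rel_e1_e2, h]
    have := CharTwo.add_self_eq_zero (vtx (0 : ℤ × ℤ) q + vtx (0 + ndisp w₂) q)
    exact this
  have hplanar := planar_decomposition hbox heven
  -- push down along the cover with a slightly larger box
  set M := N + 2 with hM
  have hproj : proj g₁ g₂ M v D = wchain g₁ g₂ v w₁ + wchain g₁ g₂ v w₂ := by
    rw [hD, proj_add, proj_wchain g₁ g₂ v w₁ 0 (by simp; omega) (by simp; omega),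
      proj_wchain g₁ g₂ v w₂ 0 (by simp; omega) (by simp; omega), map_zero, add_zero]
  rw [← hproj, hplanar, proj_sum_smul]
  refine Submodule.sum_mem _ fun f hf => Submodule.smul_mem _ _ ?_
  simp only [boxFaces, Finset.mem_product, Finset.mem_Icc] at hf
  obtain ⟨⟨hf1, hf2⟩, hf3, hf4⟩ := hf
  rw [proj_face g₁ g₂ v f]
  · exact face_mem_rowSpZ g₁ g₂ _
  all_goals simp only [eInBox, vInBox, e1, e2, Prod.fst_add, Prod.snd_add, hM, hN]
  all_goals push_cast
  all_goals omega

/-- **A closed walk whose period is twice a period is a `Z`-stabilizer** (its class is `2·[μ] = 0`).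
[cite: DennisEtAl2002, §3.1 (chunk p0008 L1-5: a cycle wrapping the torus an even number of times in each direction is homologically trivial over ℤ₂)] -/
theorem wchain_mem_rowSpZ_of_two_mul (g₁ g₂ v : G) (c : List Step) {μ : ℤ × ℤ} (hμ : IsPeriod g₁ g₂ μ)
    (hc : ndisp c = μ + μ) : wchain g₁ g₂ v c ∈ (code g₁ g₂).rowSpZ := by
  have h := wchain_add_wchain_mem_rowSpZ g₁ g₂ v c (stair μ ++ stair μ)
    (by rw [ndisp_append, ndisp_stair, hc])
  rw [wchain_append, endPos_stair_of_isPeriod hμ, chain_add_self', add_zero] at h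
  exact h

/-- Over a list: if every closed walk of the list has period in `2Λ` then the sum of their chains is a
`Z`-stabilizer. [cite: DennisEtAl2002, §3.1 (products of homologically trivial cycles are trivial)] -/
theorem list_sum_mem_rowSpZ (g₁ g₂ : G) (cs : List (G × List Step))
    (h : ∀ c ∈ cs, ∃ μ : ℤ × ℤ, IsPeriod g₁ g₂ μ ∧ ndisp c.2 = μ + μ) :
    (cs.map fun c => wchain g₁ g₂ c.1 c.2).sum ∈ (code g₁ g₂).rowSpZ := by
  induction cs with
  | nil => simp
  | cons c t ih =>
    rw [List.map_cons, List.sum_cons]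
    obtain ⟨μ, hμ, hc⟩ := h c (by simp)
    exact Submodule.add_mem _ (wchain_mem_rowSpZ_of_two_mul g₁ g₂ c.1 c.2 hμ hc)
      (ih fun c' hc' => h c' (List.mem_cons_of_mem _ hc'))

/-! ## The lower bound -/

/-- **`d_Z ≥ sys₁(Λ)` — every `Z`-logical is at least as heavy as the L¹ systole of the period lattice.** If
`H_X z = 0` and `z ∉ rs H_Z` then `sys₁ ≤ |z|`: decompose `z` into closed walks using exactly its edges; not all
of them have period in `2Λ` (else `z` would be a stabilizer), and a closed walk with period `λ ∉ 2Λ` has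
`λ ≠ 0`, hence length `≥ ‖λ‖₁ ≥ sys₁`. Holds for every finite abelian `G` and every `g₁, g₂`.
[cite: KovalevPryadko2012, §III.C (p0005 L72-80: «the shortest topologically non-trivial qubit chain has ‖L‖ operators», d(L₁,L₂) = min ‖m₁L₁ + m₂L₂‖)] -/
theorem systole_le_hammingNorm_of_zLogical (g₁ g₂ : G) (z : G ⊕ G → ZMod 2) (hz : (code g₁ g₂).HX *ᵥ z = 0)
    (hz' : z ∉ (code g₁ g₂).rowSpZ) : systole g₁ g₂ ≤ hammingNorm z := by
  have hstar : ∀ i, star g₁ g₂ z i = 0 := fun i => by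
    have := congr_fun hz i; rwa [code_HX_mulVec] at this
  obtain ⟨cs, hcl, hsum, hlen⟩ := cycle_decomposition g₁ g₂ z hstar
  -- some closed walk has period outside 2Λ
  obtain ⟨c, hc, hbad⟩ : ∃ c ∈ cs, ¬ ∃ μ : ℤ × ℤ, IsPeriod g₁ g₂ μ ∧ ndisp c.2 = μ + μ := by
    by_contra hall
    apply hz'
    rw [hsum]
    exact list_sum_mem_rowSpZ g₁ g₂ cs fun c hc => by
      by_contra hno; exact hall ⟨c, hc, hno⟩
  have hper : IsPeriod g₁ g₂ (ndisp c.2) := (closed_iff_isPeriod g₁ g₂ c.1 c.2).1 (hcl c hc)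
  have hne : ndisp c.2 ≠ 0 := by
    intro h0; exact hbad ⟨0, isPeriod_zero g₁ g₂, by rw [h0, add_zero]⟩
  calc systole g₁ g₂ ≤ l1 (ndisp c.2) := systole_le hper hne
    _ ≤ c.2.length := l1_ndisp_le_length c.2
    _ ≤ (cs.map fun c => c.2.length).sum := List.le_sum_of_mem (List.mem_map.2 ⟨c, hc, rfl⟩)
    _ = hammingNorm z := hlen

end Homology

end TwistedToric

end Literature.InformationTheory.QuantumCodes
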